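import Summits.CriticalPhenomena.PercolationContinuityZ3.Theorems.PercNearOneGluingNoHeavyLowerTailCILCutObserverTools
import HarnessLib

/-!
# `NoHeavyLowerTail` (stmt-CriticalPhenomena-4575) — tools for the cut observer with STEINER ports

Support file (prover `prim-hp-5`, technique "blob-quotient induction"; `--supports
stmt-CriticalPhenomena-4575`).  No definitions, no named facts, no sorries.  Everything here is bookkeeping
for `CutObserver.SteinerPorts.tform_transfer` (file `…CILCutObserverSteiner`), the transfer of the T-form
(guarded cumulative isolation) `μ{1 ≤ N ≤ j} ≤ μ{1 ≤ N ∧ |π(c)| ≤ j}` through an observer `o` whose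
neighbourhood inside a vertex set `W` splits into separated branches `V l` attached by single pairs
`o–p l` with ports `p l` that may be NON-relays:

* graph tools for configurations restricted to the pairs inside a vertex set (`adj_restrict_iff`,
  `reachable_restrict_mono`, `mem_of_reachable_restrict`, closed sets `mem_of_reachable_of_closed`);
* the geometry on the support event: the observer's cluster inside `W` is the union of the branch
  clusters of its open ports (`reach_observer_iff`), a branch vertex keeps its branch cluster unless it is
  joined to an open port (`reach_branch_iff`), and the counting consequences (`reach_observer_relay_iff`,
  `branchMass_le_obsCount`, `obsCount_pos_iff`, `witnessCount_eq_obsCount`, `branchCounts_of_joined`);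
* supports and independence for events read inside a vertex set (`determinedBy_restrict`,
  `determinedBy_insert_restrict`, `measureReal_open/closed_inter_restrict`), the product formula over
  pairwise disjoint branch supports (`measureReal_prodEvents_sdiff`, `measureReal_attach`), and the
  inclusion–exclusion identity `measureReal_one_le_and_le`.
-/

noncomputable section

namespace Summit.CriticalPhenomena.PercolationContinuityZ3.Theorems

open MeasureTheory Set Literature.Probability.LatticeModels Literature.Probability.Percolation
open scoped Classical BigOperators

variable {n : ℕ}

namespace CutObserver

namespace SteinerPorts

/-! ### Graph tools -/

/-- A set of vertices closed under adjacency contains everything reachable from it. [folklore] -/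
theorem mem_of_reachable_of_closed {V : Type*} (G : SimpleGraph V) (Q : Set V)
    (hQ : ∀ u ∈ Q, ∀ v, G.Adj u v → v ∈ Q) {x y : V} (hx : x ∈ Q) (h : G.Reachable x y) : y ∈ Q := by
  obtain ⟨wk⟩ := h
  induction wk with
  | nil => exact hx
  | @cons u v _ hadj _ ih => exact ih (hQ u hx v hadj)

/-- Adjacency in the configuration restricted to the pairs inside `U`. [folklore] -/
theorem adj_restrict_iff (ω : BondConfig (Fin n)) (U : Finset (Fin n)) (u v : Fin n) :
    (openGraph (ω ∩ ↑(U.sym2))).Adj u v ↔ s(u, v) ∈ ω ∧ u ∈ U ∧ v ∈ U ∧ u ≠ v := by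
  rw [openGraph, SimpleGraph.fromEdgeSet_adj, mem_inter_iff, Finset.mem_coe, Finset.mk_mem_sym2_iff]
  tauto

/-- Restricting to a smaller vertex set shrinks reachability. [folklore] -/
theorem reachable_restrict_mono {ω : BondConfig (Fin n)} {U U' : Finset (Fin n)} (hU : U ⊆ U')
    {x y : Fin n} (h : (openGraph (ω ∩ ↑(U.sym2))).Reachable x y) :
    (openGraph (ω ∩ ↑(U'.sym2))).Reachable x y :=
  reachable_mono (inter_subset_inter_right _ (Finset.coe_subset.2 (Finset.sym2_mono hU))) h

/-- Reachability inside `U` from a vertex of `U` stays inside `U`. [folklore] -/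
theorem mem_of_reachable_restrict {ω : BondConfig (Fin n)} {U : Finset (Fin n)} {x y : Fin n}
    (hx : x ∈ U) (h : (openGraph (ω ∩ ↑(U.sym2))).Reachable x y) : y ∈ U := by
  refine mem_of_reachable_of_closed _ (↑U : Set (Fin n)) (fun u _ v huv => ?_) (Finset.mem_coe.2 hx) h
  rw [adj_restrict_iff] at huv
  exact Finset.mem_coe.2 huv.2.2.1

/-! ### The cut-observer geometry with Steiner ports (pointwise, on the support event) -/

section Geometry

variable (w : Sym2 (Fin n) → unitInterval) (A W : Finset (Fin n)) (o : Fin n) {d : ℕ}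
  (V : Fin d → Finset (Fin n)) (p : Fin d → Fin n)

/-- **The observer's cluster inside `W` is the union of the branch clusters of its open ports.**  On the
support event: `o ↔ x` inside `W` iff `x = o` or some port pair `o–p l` is open and `p l ↔ x` inside `V l`.
[folklore] -/
theorem reach_observer_iff (hpV : ∀ l, p l ∈ V l) (hoV : ∀ l, o ∉ V l)
    (hoW : o ∈ W) (hVW : ∀ l, V l ⊆ W) (hcover : ∀ v ∈ W, v ≠ o → ∃ l, v ∈ V l)
    (hobs : ∀ l, ∀ v ∈ V l, v ≠ p l → w s(o, v) = 0)
    (hsep : ∀ l l', l ≠ l' → ∀ u ∈ V l, ∀ v ∈ V l', w s(u, v) = 0)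
    (ω : BondConfig (Fin n)) (hG : ∀ e ∈ ω, w e ≠ 0) (x : Fin n) :
    (openGraph (ω ∩ ↑(W.sym2))).Reachable o x ↔
      x = o ∨ ∃ l, s(o, p l) ∈ ω ∧ (openGraph (ω ∩ ↑((V l).sym2))).Reachable (p l) x := by
  constructor
  · intro h
    -- the set `Q = {o} ∪ ⋃_{open ports} (branch cluster)` is closed under adjacency
    set Q : Set (Fin n) := {y | y = o ∨ ∃ l, s(o, p l) ∈ ω ∧
      (openGraph (ω ∩ ↑((V l).sym2))).Reachable (p l) y} with hQ
    have hcl : ∀ u ∈ Q, ∀ v, (openGraph (ω ∩ ↑(W.sym2))).Adj u v → v ∈ Q := by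
      intro u hu v huv
      rw [adj_restrict_iff] at huv
      obtain ⟨huvω, huW, hvW, hne⟩ := huv
      by_cases hvo : v = o
      · exact Or.inl hvo
      obtain ⟨l', hvl'⟩ := hcover v hvW hvo
      rcases hu with rfl | ⟨l, hl, hreach⟩
      · -- an open pair at the observer goes to a port
        have hvp : v = p l' := by
          by_contra hvp
          exact hG _ huvω (hobs l' v hvl' hvp)
        refine Or.inr ⟨l', hvp ▸ huvω, ?_⟩
        rw [hvp]
      · -- `u` lies in the branch cluster of the open port `p l`; the pair `u–v` stays in `V l`
        have huVl : u ∈ V l := mem_of_reachable_restrict (hpV l) hreach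
        have hll' : l' = l := by
          by_contra hll'
          exact hG _ huvω (by rw [Sym2.eq_swap]; exact hsep l' l hll' v hvl' u huVl)
        subst hll'
        refine Or.inr ⟨l', hl, hreach.trans (SimpleGraph.Adj.reachable ?_)⟩
        rw [adj_restrict_iff]
        exact ⟨huvω, huVl, hvl', hne⟩
    exact mem_of_reachable_of_closed _ Q hcl (Or.inl rfl) h
  · rintro (rfl | ⟨l, hl, hreach⟩)
    · exact SimpleGraph.Reachable.refl _
    · have hop : (openGraph (ω ∩ ↑(W.sym2))).Adj o (p l) := by
        rw [adj_restrict_iff]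
        exact ⟨hl, hoW, hVW l (hpV l), fun h => hoV l (h ▸ hpV l)⟩
      exact hop.reachable.trans (reachable_restrict_mono (hVW l) hreach)

/-- **A branch vertex not joined (inside its branch) to an open port keeps its branch cluster.**  On the
support event, for `c ∈ V i`: unless `c ↔ p i` inside `V i` and `o–p i` is open, `c ↔ x` inside `W` iff
`c ↔ x` inside `V i`. [folklore] -/
theorem reach_branch_iff (hVW : ∀ l, V l ⊆ W) (hcover : ∀ v ∈ W, v ≠ o → ∃ l, v ∈ V l)
    (hobs : ∀ l, ∀ v ∈ V l, v ≠ p l → w s(o, v) = 0)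
    (hsep : ∀ l l', l ≠ l' → ∀ u ∈ V l, ∀ v ∈ V l', w s(u, v) = 0)
    (ω : BondConfig (Fin n)) (hG : ∀ e ∈ ω, w e ≠ 0) (i : Fin d) {c : Fin n} (hc : c ∈ V i)
    (hnot : ¬ ((openGraph (ω ∩ ↑((V i).sym2))).Reachable c (p i) ∧ s(o, p i) ∈ ω)) (x : Fin n) :
    (openGraph (ω ∩ ↑(W.sym2))).Reachable c x ↔ (openGraph (ω ∩ ↑((V i).sym2))).Reachable c x := by
  constructor
  · intro h
    set Q : Set (Fin n) := {y | (openGraph (ω ∩ ↑((V i).sym2))).Reachable c y} with hQ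
    have hcl : ∀ u ∈ Q, ∀ v, (openGraph (ω ∩ ↑(W.sym2))).Adj u v → v ∈ Q := by
      intro u hu v huv
      rw [adj_restrict_iff] at huv
      obtain ⟨huvω, huW, hvW, hne⟩ := huv
      have huVi : u ∈ V i := mem_of_reachable_restrict hc hu
      by_cases hvo : v = o
      · -- an open pair from the branch to the observer starts at the port: excluded
        subst hvo
        have hup : u = p i := by
          by_contra hup
          exact hG _ huvω (by rw [Sym2.eq_swap]; exact hobs i u huVi hup)
        subst hup
        exact absurd ⟨hu, by rw [Sym2.eq_swap]; exact huvω⟩ hnot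
      obtain ⟨l', hvl'⟩ := hcover v hvW hvo
      have hll' : l' = i := by
        by_contra hll'
        exact hG _ huvω (by rw [Sym2.eq_swap]; exact hsep l' i hll' v hvl' u huVi)
      subst hll'
      show (openGraph (ω ∩ ↑((V l').sym2))).Reachable c v
      refine SimpleGraph.Reachable.trans hu (SimpleGraph.Adj.reachable ?_)
      rw [adj_restrict_iff]
      exact ⟨huvω, huVi, hvl', hne⟩
    exact mem_of_reachable_of_closed _ Q hcl (SimpleGraph.Reachable.refl c) h
  · exact fun h => reachable_restrict_mono (hVW i) h

end Geometry

/-! ### Counting consequences of the geometry -/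

section Counting

variable (w : Sym2 (Fin n) → unitInterval) (A W : Finset (Fin n)) (o : Fin n) {d : ℕ}
  (V : Fin d → Finset (Fin n)) (p : Fin d → Fin n)

/-- On the support event, a RELAY `x` is joined to `o` inside `W` iff some port pair is open and `x` lies in
that port's branch cluster. [folklore] -/
theorem reach_observer_relay_iff (hoA : o ∉ A) (hpV : ∀ l, p l ∈ V l) (hoV : ∀ l, o ∉ V l)
    (hoW : o ∈ W) (hVW : ∀ l, V l ⊆ W) (hcover : ∀ v ∈ W, v ≠ o → ∃ l, v ∈ V l)
    (hobs : ∀ l, ∀ v ∈ V l, v ≠ p l → w s(o, v) = 0)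
    (hsep : ∀ l l', l ≠ l' → ∀ u ∈ V l, ∀ v ∈ V l', w s(u, v) = 0)
    (ω : BondConfig (Fin n)) (hG : ∀ e ∈ ω, w e ≠ 0) {x : Fin n} (hx : x ∈ A) :
    (openGraph (ω ∩ ↑(W.sym2))).Reachable o x ↔
      ∃ l, s(o, p l) ∈ ω ∧ (openGraph (ω ∩ ↑((V l).sym2))).Reachable (p l) x := by
  rw [reach_observer_iff w W o V p hpV hoV hoW hVW hcover hobs hsep ω hG x]
  have hxo : x ≠ o := fun h => hoA (h ▸ hx)
  simp only [hxo, false_or]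

/-- On the support event, the branch mass of an OPEN port is at most `N`. [folklore] -/
theorem branchMass_le_obsCount (hoA : o ∉ A) (hpV : ∀ l, p l ∈ V l) (hoV : ∀ l, o ∉ V l)
    (hoW : o ∈ W) (hVW : ∀ l, V l ⊆ W) (hcover : ∀ v ∈ W, v ≠ o → ∃ l, v ∈ V l)
    (hobs : ∀ l, ∀ v ∈ V l, v ≠ p l → w s(o, v) = 0)
    (hsep : ∀ l l', l ≠ l' → ∀ u ∈ V l, ∀ v ∈ V l', w s(u, v) = 0)
    (ω : BondConfig (Fin n)) (hG : ∀ e ∈ ω, w e ≠ 0) (l : Fin d) (hl : s(o, p l) ∈ ω) :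
    (A.filter fun x => (openGraph (ω ∩ ↑((V l).sym2))).Reachable (p l) x).card ≤
      (A.filter fun x => (openGraph (ω ∩ ↑(W.sym2))).Reachable o x).card := by
  refine Finset.card_le_card fun x hx => ?_
  rw [Finset.mem_filter] at hx ⊢
  exact ⟨hx.1, (reach_observer_relay_iff w A W o V p hoA hpV hoV hoW hVW hcover hobs hsep ω hG hx.1).2
    ⟨l, hl, hx.2⟩⟩

/-- On the support event, `1 ≤ N` iff some port pair is open with a branch cluster holding a relay.
[folklore] -/
theorem obsCount_pos_iff (hoA : o ∉ A) (hpV : ∀ l, p l ∈ V l) (hoV : ∀ l, o ∉ V l)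
    (hoW : o ∈ W) (hVW : ∀ l, V l ⊆ W) (hcover : ∀ v ∈ W, v ≠ o → ∃ l, v ∈ V l)
    (hobs : ∀ l, ∀ v ∈ V l, v ≠ p l → w s(o, v) = 0)
    (hsep : ∀ l l', l ≠ l' → ∀ u ∈ V l, ∀ v ∈ V l', w s(u, v) = 0)
    (ω : BondConfig (Fin n)) (hG : ∀ e ∈ ω, w e ≠ 0) :
    1 ≤ (A.filter fun x => (openGraph (ω ∩ ↑(W.sym2))).Reachable o x).card ↔
      ∃ l, s(o, p l) ∈ ω ∧
        1 ≤ (A.filter fun x => (openGraph (ω ∩ ↑((V l).sym2))).Reachable (p l) x).card := by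
  constructor
  · intro h1
    obtain ⟨x, hx⟩ := Finset.card_pos.1 h1
    rw [Finset.mem_filter] at hx
    obtain ⟨l, hl, hreach⟩ :=
      (reach_observer_relay_iff w A W o V p hoA hpV hoV hoW hVW hcover hobs hsep ω hG hx.1).1 hx.2
    exact ⟨l, hl, Finset.card_pos.2 ⟨x, Finset.mem_filter.2 ⟨hx.1, hreach⟩⟩⟩
  · rintro ⟨l, hl, h1⟩
    exact le_trans h1 (branchMass_le_obsCount w A W o V p hoA hpV hoV hoW hVW hcover hobs hsep ω hG l hl)

/-- A branch vertex joined inside its branch to an OPEN port has the observer's cluster (inside `W`).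
[folklore] -/
theorem witnessCount_eq_obsCount (hpV : ∀ l, p l ∈ V l) (hoV : ∀ l, o ∉ V l) (hoW : o ∈ W)
    (hVW : ∀ l, V l ⊆ W) (i : Fin d) {c : Fin n} (ω : BondConfig (Fin n))
    (hU : (openGraph (ω ∩ ↑((V i).sym2))).Reachable c (p i)) (hX : s(o, p i) ∈ ω) :
    (A.filter fun x => (openGraph (ω ∩ ↑(W.sym2))).Reachable c x).card =
      (A.filter fun x => (openGraph (ω ∩ ↑(W.sym2))).Reachable o x).card := by
  have hco : (openGraph (ω ∩ ↑(W.sym2))).Reachable c o := by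
    refine (reachable_restrict_mono (hVW i) hU).trans (SimpleGraph.Adj.reachable ?_)
    rw [adj_restrict_iff, Sym2.eq_swap]
    exact ⟨hX, hVW i (hpV i), hoW, fun h => hoV i (h ▸ hpV i)⟩
  congr 1
  exact Finset.filter_congr fun x _ => ⟨fun h => hco.symm.trans h, fun h => hco.trans h⟩

/-- If the relay `c` is joined to the port inside the branch, the branch clusters of the port and of `c`
coincide and hold a relay. [folklore] -/
theorem branchCounts_of_joined (i : Fin d) {c : Fin n} (hcA : c ∈ A) (ω : BondConfig (Fin n))
    (hU : (openGraph (ω ∩ ↑((V i).sym2))).Reachable c (p i)) :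
    (A.filter fun x => (openGraph (ω ∩ ↑((V i).sym2))).Reachable (p i) x).card =
        (A.filter fun x => (openGraph (ω ∩ ↑((V i).sym2))).Reachable c x).card ∧
      1 ≤ (A.filter fun x => (openGraph (ω ∩ ↑((V i).sym2))).Reachable (p i) x).card := by
  constructor
  · congr 1
    exact Finset.filter_congr fun x _ => ⟨fun h => hU.trans h, fun h => hU.symm.trans h⟩
  · exact Finset.card_pos.2 ⟨c, Finset.mem_filter.2 ⟨hcA, hU.symm⟩⟩

end Counting

/-! ### Monotonicity and supports of the branch events -/

/-- The number of relays reachable from `y` inside `U` is monotone in the configuration. [folklore] -/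
theorem card_filter_reachable_mono (A U : Finset (Fin n)) (y : Fin n) {ω ω' : BondConfig (Fin n)}
    (h : ω ⊆ ω') :
    (A.filter fun x => (openGraph (ω ∩ ↑(U.sym2))).Reachable y x).card ≤
      (A.filter fun x => (openGraph (ω' ∩ ↑(U.sym2))).Reachable y x).card :=
  Finset.card_le_card fun x hx => by
    rw [Finset.mem_filter] at hx ⊢
    exact ⟨hx.1, reachable_mono (inter_subset_inter_left _ h) hx.2⟩

/-- An event read off the configuration restricted to the pairs inside `U` is determined by `U.sym2`.
[folklore] -/
theorem determinedBy_restrict (U : Finset (Fin n)) (Φ : BondConfig (Fin n) → Prop) :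
    DeterminedBy {ω : BondConfig (Fin n) | Φ (ω ∩ ↑(U.sym2))} (↑(U.sym2) : Set (Sym2 (Fin n))) := by
  rw [determinedBy_iff]
  intro ω ω' h
  simp only [mem_setOf_eq]
  rw [h]

/-- An event read off one pair `e ∉ U.sym2`-or-not and the configuration inside `U` is determined by
`insert e U.sym2`. [folklore] -/
theorem determinedBy_insert_restrict (U : Finset (Fin n)) (e : Sym2 (Fin n))
    (Φ : Prop → BondConfig (Fin n) → Prop) :
    DeterminedBy {ω : BondConfig (Fin n) | Φ (e ∈ ω) (ω ∩ ↑(U.sym2))}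
      (↑(insert e U.sym2) : Set (Sym2 (Fin n))) := by
  rw [determinedBy_iff]
  intro ω ω' h
  have he : (e ∈ ω) = (e ∈ ω') := by
    have := Set.ext_iff.1 h e
    simp only [Finset.coe_insert, mem_inter_iff, mem_insert_iff, true_or, and_true] at this
    exact propext this
  have hU : ω ∩ ↑(U.sym2) = ω' ∩ ↑(U.sym2) := by
    ext f
    have := Set.ext_iff.1 h f
    simp only [Finset.coe_insert, mem_inter_iff, mem_insert_iff, Finset.mem_coe] at this ⊢
    constructor
    · rintro ⟨hf, hfU⟩; exact ⟨(this.1 ⟨hf, Or.inr hfU⟩).1, hfU⟩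
    · rintro ⟨hf, hfU⟩; exact ⟨(this.2 ⟨hf, Or.inr hfU⟩).1, hfU⟩
  simp only [mem_setOf_eq]
  rw [he, hU]

/-- `μ({e open} ∩ E) = w e · μ(E)` for an event `E` read inside `U`, `e ∉ U.sym2`. [folklore] -/
theorem measureReal_open_inter_restrict (w : Sym2 (Fin n) → unitInterval) (U : Finset (Fin n))
    (e : Sym2 (Fin n)) (he : e ∉ U.sym2) (Φ : BondConfig (Fin n) → Prop) :
    (prodBernoulli w).real ({ω : BondConfig (Fin n) | e ∈ ω} ∩ {ω | Φ (ω ∩ ↑(U.sym2))}) =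
      w e * (prodBernoulli w).real {ω : BondConfig (Fin n) | Φ (ω ∩ ↑(U.sym2))} := by
  rw [prodBernoulli_real_inter_of_determinedBy_disjoint w (Finset.disjoint_singleton_left.2 he)
    (determinedBy_open e) (determinedBy_restrict U Φ) MeasurableSet.of_discrete
    MeasurableSet.of_discrete, measureReal_open]

/-- `μ({e closed} ∩ E) = (1 − w e) · μ(E)` for an event `E` read inside `U`, `e ∉ U.sym2`. [folklore] -/
theorem measureReal_closed_inter_restrict (w : Sym2 (Fin n) → unitInterval) (U : Finset (Fin n))
    (e : Sym2 (Fin n)) (he : e ∉ U.sym2) (Φ : BondConfig (Fin n) → Prop) :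
    (prodBernoulli w).real ({ω : BondConfig (Fin n) | e ∉ ω} ∩ {ω | Φ (ω ∩ ↑(U.sym2))}) =
      (1 - w e) * (prodBernoulli w).real {ω : BondConfig (Fin n) | Φ (ω ∩ ↑(U.sym2))} := by
  rw [prodBernoulli_real_inter_of_determinedBy_disjoint w (Finset.disjoint_singleton_left.2 he)
    (determinedBy_closed e) (determinedBy_restrict U Φ) MeasurableSet.of_discrete
    MeasurableSet.of_discrete, measureReal_closed]

/-- Inclusion–exclusion for a natural-valued observable: `μ{1 ≤ f ≤ j} = μ{f ≤ j} + μ{1 ≤ f} − 1`.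
[folklore] -/
theorem measureReal_one_le_and_le (w : Sym2 (Fin n) → unitInterval) (f : BondConfig (Fin n) → ℕ)
    (j : ℕ) :
    (prodBernoulli w).real {ω : BondConfig (Fin n) | 1 ≤ f ω ∧ f ω ≤ j} =
      (prodBernoulli w).real {ω : BondConfig (Fin n) | f ω ≤ j} +
        (prodBernoulli w).real {ω : BondConfig (Fin n) | 1 ≤ f ω} - 1 := by
  haveI : IsProbabilityMeasure (prodBernoulli w) := inferInstance
  have huniv : ({ω : BondConfig (Fin n) | f ω ≤ j} ∪ {ω | 1 ≤ f ω}) = univ := by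
    ext ω
    simp only [mem_union, mem_setOf_eq, mem_univ, iff_true]
    omega
  have hinter : ({ω : BondConfig (Fin n) | f ω ≤ j} ∩ {ω | 1 ≤ f ω}) = {ω | 1 ≤ f ω ∧ f ω ≤ j} := by
    ext ω
    simp only [mem_inter_iff, mem_setOf_eq]
    tauto
  have h := measureReal_union_add_inter (μ := prodBernoulli w) (s := {ω : BondConfig (Fin n) | f ω ≤ j})
    (MeasurableSet.of_discrete (s := {ω | 1 ≤ f ω}))
  rw [huniv, hinter, probReal_univ] at h
  linarith

/-- **Product formula over pairwise disjoint branch supports.**  If `Yc l ⊆ NF l` (`l ∈ T`) are determined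
by pairwise disjoint supports `S l` and `E` by the complement of their union, then
`μ((E ∩ ⋂ NF l) ∖ (E ∩ ⋂ Yc l)) = μ(E)·(∏ μ(NF l) − ∏ μ(Yc l))`. [folklore] -/
theorem measureReal_prodEvents_sdiff (w : Sym2 (Fin n) → unitInterval) {ι : Type*} (T : Finset ι)
    (S : ι → Finset (Sym2 (Fin n))) (hS : (↑T : Set ι).PairwiseDisjoint S)
    (NF Yc : ι → Set (BondConfig (Fin n)))
    (hNF : ∀ l ∈ T, DeterminedBy (NF l) (↑(S l) : Set (Sym2 (Fin n))))
    (hYc : ∀ l ∈ T, DeterminedBy (Yc l) (↑(S l) : Set (Sym2 (Fin n))))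
    (hsub : ∀ l ∈ T, Yc l ⊆ NF l) (E : Set (BondConfig (Fin n)))
    (hE : DeterminedBy E (⋃ l ∈ T, (↑(S l) : Set (Sym2 (Fin n))))ᶜ) :
    (prodBernoulli w).real ((E ∩ ⋂ l ∈ T, NF l) \ (E ∩ ⋂ l ∈ T, Yc l)) =
      (prodBernoulli w).real E *
        (∏ l ∈ T, (prodBernoulli w).real (NF l) - ∏ l ∈ T, (prodBernoulli w).real (Yc l)) := by
  have hQP : (E ∩ ⋂ l ∈ T, Yc l) ⊆ E ∩ ⋂ l ∈ T, NF l :=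
    inter_subset_inter_right _ (biInter_mono (fun l hl => hl) fun l hl => hsub l hl)
  rw [measureReal_sdiff hQP MeasurableSet.of_discrete,
    prodBernoulli_real_inter_biInter_of_determinedBy w T S hS hNF (fun l _ => MeasurableSet.of_discrete)
      hE MeasurableSet.of_discrete,
    prodBernoulli_real_inter_biInter_of_determinedBy w T S hS hYc (fun l _ => MeasurableSet.of_discrete)
      hE MeasurableSet.of_discrete, mul_sub]

/-- **The attachment event.**  With `Yc l` determined by pairwise disjoint supports `S l` (`l ∈ T`) and `E`
by the complement of their union: `μ(E ∖ (E ∩ ⋂ Yc l)) = μ(E)·(1 − ∏ μ(Yc l))`. [folklore] -/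
theorem measureReal_attach (w : Sym2 (Fin n) → unitInterval) {ι : Type*} (T : Finset ι)
    (S : ι → Finset (Sym2 (Fin n))) (hS : (↑T : Set ι).PairwiseDisjoint S)
    (Yc : ι → Set (BondConfig (Fin n)))
    (hYc : ∀ l ∈ T, DeterminedBy (Yc l) (↑(S l) : Set (Sym2 (Fin n))))
    (E : Set (BondConfig (Fin n)))
    (hE : DeterminedBy E (⋃ l ∈ T, (↑(S l) : Set (Sym2 (Fin n))))ᶜ) :
    (prodBernoulli w).real (E \ (E ∩ ⋂ l ∈ T, Yc l)) =
      (prodBernoulli w).real E * (1 - ∏ l ∈ T, (prodBernoulli w).real (Yc l)) := by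
  rw [measureReal_sdiff inter_subset_left MeasurableSet.of_discrete,
    prodBernoulli_real_inter_biInter_of_determinedBy w T S hS hYc (fun l _ => MeasurableSet.of_discrete)
      hE MeasurableSet.of_discrete]
  ring

/-- Reading a configuration inside `Finset.univ` changes nothing. [folklore] -/
theorem inter_univ_sym2 (ω : BondConfig (Fin n)) :
    ω ∩ ↑((Finset.univ : Finset (Fin n)).sym2) = ω := by
  ext e
  simp only [mem_inter_iff, Finset.mem_coe, Finset.mem_sym2_iff, Finset.mem_univ, implies_true,
    and_true]

end SteinerPorts

end CutObserver

end Summit.CriticalPhenomena.PercolationContinuityZ3.Theorems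

end
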